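import Mathlib
import Literature.Computability.AlgebraicComplexity.FSS14RankConcentration
import HarnessLib

/-!
# Forbes–Shpilka 2012, Thm. 4.1 / Lemma 4.2 / Cor. 4.3: the improved Gabizon–Raz rank condenser
# `(A_α)_{i,j} = (g^i α)^j` — proofs, no named facts

M. A. Forbes, A. Shpilka, *On identity testing of tensors, low-rank recovery and compressed sensing*,
STOC 2012 = arXiv:1111.0663 [ForbesShpilka2012], §4 "Improved construction of rank-preserving
matrices" (paper:arxiv-1111.0663 p0015–p0016). This is the rank extractor cited as Lemma 3.4
(arXiv numbering: Lemma 9, "[ForbesShpilka12]") of [ForbesShpilka2013] (arXiv:1209.2408 §3.1,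
paper:arxiv-1209.2408 p0013.txt), the dimension-reduction step of the Forbes–Shpilka generator for
read-once oblivious ABPs (FSV 2018 Lemma 55, `ForbesShpilkaVolk2018_lemma55` of
`FSV2018ROABP.lean`; the `ω^{ℓ_i} y_i` of FSV eq. (7.1) is this `g^i α`). Vendored here as a step
towards that named fact; nothing in this file bears on `VP ≠ VNP`.

**Thm. 4.1** (printed): "Let `1 ≤ r ≤ n`. Let `M ∈ 𝔽^{n×r}` be of rank `r`. Let `𝕂` be a field
extending `𝔽`, and let `g ∈ 𝕂` be an element of order `≥ n`. Define `A_α ∈ 𝕂^{r×n}` by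
`(A_α)_{i,j} = (g^i α)^j`. Then there are `≤ nr − binom(r+1, 2) < nr` values `α ∈ 𝕂` such that
`rank(A_α M) < r`." **Cor. 4.3** (printed): "Let `1 ≤ s ≤ r ≤ n`. Let `M ∈ 𝔽^{n×r'}` be of rank
`s`, for `r' ≥ s` … Then there are `≤ nr − binom(r+1, 2) < nr` values `α ∈ 𝕂` such that the first
`s` rows of `A_α M` have rank `< s`."

Typed over ONE field `K` (= the printed `𝕂`; a matrix over a subfield is a matrix over `K` of the
same rank), indices `i < r`, `j < n` from `0` as printed (`⟦n⟧ = {0, …, n-1}`), and with the order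
hypothesis in the form the printed proof uses — "the elements `(g^k)_{0≤k<n}` are distinct"
(`Set.InjOn (g ^ ·) (Set.Iio n)`; from `n ≤ orderOf g`, or from `g ≠ 0 ∧ ∀ 0 < k < n, g^k ≠ 1` as
in the typed FSV Lemma 55, by `pow_injOn_Iio_of_le_orderOf` / `pow_injOn_Iio_of_forall_pow_ne_one`):
* `det_condenser_mul_ne_zero` — Thm. 4.1, polynomial form: for `M ∈ K^{n×r}` with linearly
  independent columns, `det(A(X) · M) ≠ 0` in `K[X]` (`A(X)_{i,j} = g^{ij} X^j`, `condenser`), and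
  `natDegree det(A(X) · M) + binom(r+1, 2) ≤ n r` (`natDegree_det_condenser_mul_add_choose_le`);
* `card_add_choose_le_of_det_eq_zero` — Thm. 4.1 as printed: any finite set of `α` with
  `det(A_α M) = 0` has `≤ nr − binom(r+1, 2)` elements (`A_α = condenserAt g α r n`);
* `card_add_choose_le_of_rank_lt` — a consequence of Cor. 4.3 in rank form (the full-rank-drop
  shape the printed proof of [FS13, Lemma 3.5] consumes): for ANY `M ∈ K^{n×ρ}` of rank `s ≤ r`,
  all but `≤ ns − binom(s+1, 2)` values `α` satisfy `rank(A_α M) = rank M` (the first `s` rows of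
  the `r`-row condenser are the `s`-row condenser, `submatrix_condenserAt_mul`). The set of `α`
  bounded here is contained in (in general strictly) the printed bad set "the first `s` rows of
  `A_α M` have rank `< s`" of Cor. 4.3 / [FS13, Lemma 3.4]; see that theorem's docstring.

Architecture = the printed one with ONE deviation, the same as in `FSS14RankConcentration.lean`
(whose [FSS14, Lemma 17] engine `FSS2014.mulVec_weighted_ne_zero` is reused verbatim): print
expands `det(A M)` by Cauchy–Binet, `det(A_S) = α^{Σ_{k∈S} k} · Vandermonde(g^{k_1}, …, g^{k_r})`,
and shows no cancellation at the extreme degree because the maximiser of `Σ_{k∈S} k` over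
`{S : det M_S ≠ 0}` is unique (Lemma 4.2, Steinitz exchange). Here: the column space of `M` has a
basis `U = M P` in echelon form for the row index (`FSS2014.exists_echelon`; its pivot rows ARE the
extremal `S` of Lemma 4.2), every `r` columns of `(g^{ij})_{i<r, j<n}` are independent (Vandermonde
on the distinct nodes `g^j`, `vandermondeCode`), hence `A(X) U` has no kernel over `K[X]`
(`FSS2014.mulVec_weighted_ne_zero`: the top monomial of `A U λ` sits on the pivot columns), so
`det(A U) = det(A M) det P ≠ 0`; and column `t` of `A(X) U` has degree `≤ p_t` (its pivot row), so
`deg det(A M) = deg det(A U) ≤ Σ_t p_t ≤ Σ_{k=n-r}^{n-1} k = nr − binom(r+1, 2)`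
(`sum_add_choose_le_mul`). Cauchy–Binet is thereby avoided; the statements proved are exactly the
printed conclusions.

## References
* [ForbesShpilka2012] arXiv:1111.0663, Thm. 4.1, Lemma 4.2, Cor. 4.3 (locator:
  paper:arxiv-1111.0663 p0015.txt:L24 – p0016.txt:L30).
* [ForbesShpilka2013] arXiv:1209.2408, §3.1 Lemma 3.4 (arXiv: Lemma 9) (locator:
  paper:arxiv-1209.2408 p0013.txt:L60–L63).
* [GabizonRaz2008] Lemma 6.1 (the `α^{ij}` condenser; tree: `ASSS16.rank_mul_powMatrix_eq_rank`).
-/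

noncomputable section

open Polynomial Matrix Finset

open scoped BigOperators

namespace Literature.Computability.AlgebraicComplexity

namespace FS2012

variable {K : Type*} [Field K]

/-! ### The condenser matrices -/

/-- **The Forbes–Shpilka rank condenser with a formal `α`:** `A(X) ∈ K[X]^{r×n}`,
`A(X)_{i,j} = g^{ij} X^j`, so that `A(α)_{i,j} = (g^i α)^j` (`condenser_map_eval`).
[cite: ForbesShpilka2012, Thm. 4.1 ("Define `A_α ∈ 𝕂^{r×n}` by `(A_α)_{i,j} = (g^i α)^j`"; proof:
"We will now treat `α` as a variable")] locator: paper:arxiv-1111.0663 p0015.txt:L25–L31 -/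
def condenser (g : K) (r n : ℕ) : Matrix (Fin r) (Fin n) K[X] :=
  Matrix.of fun i j => C (g ^ ((i : ℕ) * (j : ℕ))) * X ^ (j : ℕ)

/-- `A_α ∈ K^{r×n}`, `(A_α)_{i,j} = (g^i α)^j`. [cite: ForbesShpilka2012, Thm. 4.1]
locator: paper:arxiv-1111.0663 p0015.txt:L26 -/
def condenserAt (g α : K) (r n : ℕ) : Matrix (Fin r) (Fin n) K :=
  Matrix.of fun i j => (g ^ (i : ℕ) * α) ^ (j : ℕ)

/-- Entries of `A(X)`. [cite: ForbesShpilka2012, Thm. 4.1 ("`(A_α)_{i,j} = (g^i α)^j`")]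
locator: paper:arxiv-1111.0663 p0015.txt:L26 -/
@[simp] theorem condenser_apply (g : K) (r n : ℕ) (i : Fin r) (j : Fin n) :
    condenser g r n i j = C (g ^ ((i : ℕ) * (j : ℕ))) * X ^ (j : ℕ) := rfl

/-- Entries of `A_α`. [cite: ForbesShpilka2012, Thm. 4.1 ("`(A_α)_{i,j} = (g^i α)^j`")]
locator: paper:arxiv-1111.0663 p0015.txt:L26 -/
@[simp] theorem condenserAt_apply (g α : K) (r n : ℕ) (i : Fin r) (j : Fin n) :
    condenserAt g α r n i j = (g ^ (i : ℕ) * α) ^ (j : ℕ) := rfl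

/-- `A(X)` evaluated at `X = α` is `A_α`. [cite: ForbesShpilka2012, Thm. 4.1 (proof, first line)] -/
theorem condenser_map_eval (g α : K) (r n : ℕ) :
    (condenser g r n).map (Polynomial.eval α) = condenserAt g α r n := by
  ext i j
  simp only [map_apply, condenser_apply, condenserAt_apply, eval_mul, eval_C, eval_pow, eval_X,
    mul_pow, pow_mul]

/-- `det(A_α M)` is the value at `α` of the polynomial `det(A(X) M)`.
[cite: ForbesShpilka2012, Thm. 4.1 (proof: "the claim will follow from showing that `det(AM)` is a
non-zero polynomial in `α`")] locator: paper:arxiv-1111.0663 p0015.txt:L29–L31 -/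
theorem det_condenserAt_mul {r n : ℕ} (g α : K) (M : Matrix (Fin n) (Fin r) K) :
    (condenserAt g α r n * M).det = ((condenser g r n * M.map (C : K →+* K[X])).det).eval α := by
  rw [← Polynomial.coe_evalRingHom, RingHom.map_det, RingHom.mapMatrix_apply, Matrix.map_mul,
    Matrix.map_map]
  congr 2
  · exact (condenser_map_eval g α r n).symm
  · ext i j
    simp

/-- The first `s` rows of `A_α^{(r)} M` (`s ≤ r`) on the columns `f` form `A_α^{(s)} (M|_f)`.
[cite: ForbesShpilka2012, Cor. 4.3 (proof: "`A'_α M` is exactly the first `s` rows of `A_α M`")]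
locator: paper:arxiv-1111.0663 p0016.txt:L28–L30 -/
theorem submatrix_condenserAt_mul {r n s : ℕ} {ρ ρ' : Type*} [Fintype ρ] (g α : K) (hs : s ≤ r)
    (M : Matrix (Fin n) ρ K) (f : ρ' → ρ) :
    (condenserAt g α r n * M).submatrix (Fin.castLE hs) f = condenserAt g α s n * M.submatrix id f := by
  ext i t
  simp [Matrix.mul_apply]

/-! ### The order hypothesis: `1, g, …, g^{n-1}` are distinct -/

/-- "The elements `(g^k)_{0≤k<n}` are distinct" — the only use of "`g` has order `≥ n`" in the
printed proof — is Mathlib's `Set.InjOn (fun k : ℕ => g ^ k) (Set.Iio n)`; from `n ≤ orderOf g` it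
is `pow_injOn_Iio_orderOf`. [cite: ForbesShpilka2012, Thm. 4.1 (proof)]
locator: paper:arxiv-1111.0663 p0015.txt:L70–L71 -/
theorem pow_injOn_Iio_of_le_orderOf {g : K} {n : ℕ} (hn : n ≤ orderOf g) :
    Set.InjOn (fun k : ℕ => g ^ k) (Set.Iio n) :=
  fun _ ha _ hb h =>
    pow_injOn_Iio_orderOf (Set.mem_Iio.mpr (lt_of_lt_of_le (Set.mem_Iio.mp ha) hn))
      (Set.mem_Iio.mpr (lt_of_lt_of_le (Set.mem_Iio.mp hb) hn)) h

/-- The form used by the typed FSV Lemma 55 ("`ω ∈ 𝔽` of multiplicative order at least `K`",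
typed as `ω ≠ 0` and `ω^k ≠ 1` for `0 < k < K`) implies that `1, ω, …, ω^{K-1}` are distinct — the
property the printed proof of Thm. 4.1 uses.
[cite: ForbesShpilka2012, Thm. 4.1 (proof: "the order of `g` is `≥ n`, so the elements
`(g^k)_{0≤k<n}` are distinct"); ForbesShpilkaVolk2018, Lemma 55 (seq.; = ToC Lemma 7.1), hypothesis on `ω`]
locator: paper:arxiv-1111.0663 p0015.txt:L70–L71 -/
theorem pow_injOn_Iio_of_forall_pow_ne_one {g : K} {n : ℕ} (hg0 : g ≠ 0)
    (hg : ∀ k : ℕ, 0 < k → k < n → g ^ k ≠ 1) : Set.InjOn (fun k : ℕ => g ^ k) (Set.Iio n) := by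
  have key : ∀ a b : ℕ, b < n → g ^ a = g ^ b → a < b → False := by
    intro a b hb hab hlt
    have h1 : g ^ b = g ^ a * g ^ (b - a) := by rw [← pow_add, Nat.add_sub_cancel' hlt.le]
    have h2 : g ^ a * (g ^ (b - a) - 1) = 0 := by rw [mul_sub, mul_one, ← h1, hab, sub_self]
    rcases mul_eq_zero.mp h2 with h | h
    · exact pow_ne_zero _ hg0 h
    · exact hg (b - a) (Nat.sub_pos_of_lt hlt) (lt_of_le_of_lt (Nat.sub_le b a) hb)
        (sub_eq_zero.mp h)
  intro a ha b hb hab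
  rw [Set.mem_Iio] at ha hb
  simp only at hab
  by_contra hne
  rcases Nat.lt_or_gt_of_ne hne with hlt | hlt
  · exact key a b hb hab hlt
  · exact key b a ha hab.symm hlt

/-! ### Every `r` columns of `(g^{ij})_{i<r, j<n}` are independent (the Vandermonde factor) -/

/-- For `I ⊆ ⟦n⟧` with `|I| ≤ r`, the columns `j ∈ I` of `(g^{ij})_{i<r, j<n} = ((g^j)^i)` are
linearly independent: a Vandermonde system on the distinct nodes `g^j`.
[cite: ForbesShpilka2012, Thm. 4.1 (proof: "`det(A_S) = α^{Σ k_ℓ} ∏_{i<j} (g^{k_j} − g^{k_i})` …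
the above Vandermonde determinant is non-zero")] locator: paper:arxiv-1111.0663 p0015.txt:L52–L71 -/
theorem vandermondeCode {g : K} {n r : ℕ} (hg : Set.InjOn (fun k : ℕ => g ^ k) (Set.Iio n))
    (I : Finset (Fin n))
    (hI : I.card ≤ r) (κ : Fin n → K)
    (hκ : ∀ i : Fin r, ∑ j ∈ I, κ j * g ^ ((i : ℕ) * (j : ℕ)) = 0) : ∀ j ∈ I, κ j = 0 := by
  classical
  set k := I.card with hk
  let emb : Fin k ≃ I := I.equivFin.symm
  let f : Fin k → K := fun a => g ^ ((emb a : Fin n) : ℕ)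
  let v : Fin k → K := fun a => κ (emb a)
  have hf : Function.Injective f := by
    intro a b hab
    have h := hg (Set.mem_Iio.mpr (emb a : Fin n).isLt) (Set.mem_Iio.mpr (emb b : Fin n).isLt) hab
    exact emb.injective (Subtype.ext (Fin.ext h))
  have hfv : ∀ i : Fin k, ∑ a : Fin k, v a * f a ^ (i : ℕ) = 0 := by
    intro i
    have hi : (i : ℕ) < r := lt_of_lt_of_le i.isLt hI
    have h := hκ ⟨i, hi⟩
    rw [← Finset.sum_coe_sort, ← emb.sum_comp] at h
    rw [← h]
    refine Finset.sum_congr rfl fun a _ => ?_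
    change κ (emb a : Fin n) * (g ^ ((emb a : Fin n) : ℕ)) ^ (i : ℕ) =
      κ (emb a : Fin n) * g ^ ((i : ℕ) * ((emb a : Fin n) : ℕ))
    rw [← pow_mul, Nat.mul_comm]
  have hv := Matrix.eq_zero_of_forall_pow_sum_mul_pow_eq_zero hf hfv
  intro j hj
  have h := congr_fun hv (emb.symm ⟨j, hj⟩)
  simpa [v] using h

/-! ### Lemma 4.2 replaced by a sum bound on distinct row indices -/

/-- `Σ_{x∈S} x + binom(|S|+1, 2) ≤ n·|S|` for `S ⊆ ⟦n⟧` — i.e. `Σ_{k∈S} k ≤ Σ_{k=n-|S|}^{n-1} k =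
n|S| − binom(|S|+1, 2)`, the degree count of the printed proof ("`Σ_{k∈S} k ≤ Σ_{k=n-r}^{n-1} k
= nr − binom(r+1, 2)`"). [cite: ForbesShpilka2012, Thm. 4.1 (proof, degree count)]
locator: paper:arxiv-1111.0663 p0015.txt:L73–L75 -/
theorem sum_add_choose_le_mul :
    ∀ (n : ℕ) (S : Finset ℕ), (∀ x ∈ S, x < n) → S.sum id + (S.card + 1).choose 2 ≤ n * S.card := by
  intro n
  induction n with
  | zero =>
    intro S hS
    have hS0 : S = ∅ := Finset.eq_empty_of_forall_notMem fun x hx => absurd (hS x hx) (Nat.not_lt_zero x)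
    subst hS0
    simp
  | succ n ih =>
    intro S hS
    by_cases hn : n ∈ S
    · have hS'lt : ∀ x ∈ S.erase n, x < n := fun x hx => by
        rcases Finset.mem_erase.mp hx with ⟨hxn, hxS⟩
        exact lt_of_le_of_ne (Nat.lt_succ_iff.mp (hS x hxS)) hxn
      have hih := ih (S.erase n) hS'lt
      have hcard : S.card = (S.erase n).card + 1 := (Finset.card_erase_add_one hn).symm
      have hsum : S.sum id = (S.erase n).sum id + n := by
        rw [← Finset.add_sum_erase S id hn, add_comm]; rfl
      have hc : ((S.erase n).card + 1 + 1).choose 2 =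
          ((S.erase n).card + 1).choose 1 + ((S.erase n).card + 1).choose 2 := rfl
      rw [Nat.choose_one_right] at hc
      rw [hcard, hsum, hc]
      have e : (n + 1) * ((S.erase n).card + 1) = n * (S.erase n).card + n + (S.erase n).card + 1 := by
        ring
      omega
    · have hSlt : ∀ x ∈ S, x < n := fun x hx =>
        lt_of_le_of_ne (Nat.lt_succ_iff.mp (hS x hx)) fun h => hn (h ▸ hx)
      exact (ih S hSlt).trans (Nat.mul_le_mul_right _ (Nat.le_succ n))

/-- For distinct row indices `p_1, …, p_r < n`: `Σ_t p_t + binom(r+1, 2) ≤ n r`.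
[cite: ForbesShpilka2012, Thm. 4.1 (proof, degree count)] locator: paper:arxiv-1111.0663 p0015.txt:L73–L75 -/
theorem sum_val_add_choose_le_mul {n r : ℕ} (p : Fin r → Fin n) (hp : Function.Injective p) :
    ∑ t, (p t : ℕ) + (r + 1).choose 2 ≤ n * r := by
  classical
  set S : Finset ℕ := Finset.univ.image fun t => (p t : ℕ) with hS
  have hinj : Function.Injective fun t => (p t : ℕ) := Fin.val_injective.comp hp
  have hcard : S.card = r := by
    rw [hS, Finset.card_image_of_injective _ hinj, Finset.card_univ, Fintype.card_fin]
  have hsum : S.sum id = ∑ t, (p t : ℕ) := by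
    rw [hS, Finset.sum_image fun a _ b _ h => hinj h]
    rfl
  have hlt : ∀ x ∈ S, x < n := by
    intro x hx
    obtain ⟨t, -, rfl⟩ := Finset.mem_image.mp hx
    exact (p t).isLt
  have h := sum_add_choose_le_mul n S hlt
  rwa [hsum, hcard] at h

/-! ### Thm. 4.1 -/

/-- **[ForbesShpilka2012, Thm. 4.1], polynomial form (with the degree bound).** If
`1, g, …, g^{n-1}` are distinct and `M ∈ K^{n×r}` has linearly independent columns, then
`det(A(X) · M)` is a non-zero polynomial with `natDegree + binom(r+1, 2) ≤ nr`.
[cite: ForbesShpilka2012, Thm. 4.1 (proof: "`det(AM)` is a non-zero polynomial in `α` of degree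
`≤ nr − binom(r+1, 2)`")] locator: paper:arxiv-1111.0663 p0015.txt:L29–L31, L80–L82 -/
theorem det_condenser_mul_ne_zero_and_natDegree_le {g : K} {n r : ℕ} (hg : Set.InjOn (fun k : ℕ => g ^ k) (Set.Iio n))
    (M : Matrix (Fin n) (Fin r) K) (hM : LinearIndependent K Mᵀ) :
    (condenser g r n * M.map (C : K →+* K[X])).det ≠ 0 ∧
      (condenser g r n * M.map (C : K →+* K[X])).det.natDegree + (r + 1).choose 2 ≤ n * r := by
  classical
  -- the column space and an echelon basis of it for the row index
  set V : Submodule K (Fin n → K) := Submodule.span K (Set.range Mᵀ) with hV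
  have hVr : Module.finrank K V = r := by
    rw [hV, finrank_span_eq_card hM, Fintype.card_fin]
  obtain ⟨u, p, huV, hp, hpiv, hech⟩ :=
    FSS2014.exists_echelon (F := K) (X := Fin n) (O := ℕ) (fun j : Fin n => (j : ℕ)) r V hVr
  -- `U = M P`
  have hex : ∀ t, ∃ c : Fin r → K, ∑ s, c s • Mᵀ s = u t := fun t =>
    (Submodule.mem_span_range_iff_exists_fun (R := K)).mp (huV t)
  choose P' hP' using hex
  set U : Matrix (Fin n) (Fin r) K := Matrix.of fun j t => u t j with hU
  set P : Matrix (Fin r) (Fin r) K := Matrix.of fun s t => P' t s with hPdef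
  have hUMP : U = M * P := by
    ext j t
    have h := congr_fun (hP' t) j
    simp only [Finset.sum_apply, Pi.smul_apply, transpose_apply, smul_eq_mul] at h
    rw [hU, Matrix.of_apply, ← h, Matrix.mul_apply]
    exact Finset.sum_congr rfl fun s _ => by rw [hPdef, Matrix.of_apply, mul_comm]
  set A := condenser g r n with hA
  -- entries of `A U`
  have hentry : ∀ i t, (A * U.map (C : K →+* K[X])) i t =
      ∑ j : Fin n, Polynomial.monomial (j : ℕ) (u t j * g ^ ((i : ℕ) * (j : ℕ))) := by
    intro i t
    simp only [Matrix.mul_apply, hA, condenser_apply, Matrix.map_apply, hU, Matrix.of_apply]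
    refine Finset.sum_congr rfl fun j _ => ?_
    rw [Polynomial.C_mul_X_pow_eq_monomial, Polynomial.monomial_mul_C, mul_comm]
  -- Step 1: `A U` has no kernel over `K[X]` (FSS14 Lemma 17 engine), hence `det (A U) ≠ 0`
  have hAU : (A * U.map (C : K →+* K[X])).det ≠ 0 := by
    intro h0
    obtain ⟨v, hv, hAv⟩ := Matrix.exists_mulVec_eq_zero_iff.mpr h0
    set φ := MvPolynomial.uniqueAlgEquiv K Unit with hφ
    set lam : Fin r → MvPolynomial Unit K := fun t => φ.symm (v t) with hlam
    have hlam0 : lam ≠ 0 := by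
      intro h
      apply hv
      funext t
      have ht := congr_fun h t
      simp only [hlam, Pi.zero_apply, map_eq_zero_iff φ.symm φ.symm.injective] at ht
      exact ht
    have he : Function.Injective fun j : Fin n => Finsupp.single () (j : ℕ) := by
      intro a b hab
      exact Fin.ext (by simpa using congr_arg (fun f : Unit →₀ ℕ => f ()) hab)
    have hcode : ∀ (I : Finset (Fin n)), I.card ≤ r → ∀ κ : Fin n → K,
        (∀ y : Fin r, ∑ x ∈ I, κ x * (fun (i : Fin r) (j : Fin n) => g ^ ((i : ℕ) * (j : ℕ))) y x = 0) →
          ∀ x ∈ I, κ x = 0 :=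
      fun I hI κ hκ => vandermondeCode hg I hI κ hκ
    have hech' : ∀ i x, u i x ≠ 0 →
        (MonomialOrder.lex (σ := Unit)).toSyn (Finsupp.single () (x : ℕ)) ≤
          (MonomialOrder.lex (σ := Unit)).toSyn (Finsupp.single () ((p i : Fin n) : ℕ)) := by
      intro i x hx
      exact (MonomialOrder.lex (σ := Unit)).toSyn_monotone
        (Finsupp.single_mono (hech i x hx))
    have key := FSS2014.mulVec_weighted_ne_zero (MonomialOrder.lex (σ := Unit))
      (fun j : Fin n => Finsupp.single () (j : ℕ)) he (fun _ => (1 : K)) (fun _ => one_ne_zero)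
      (fun (i : Fin r) (j : Fin n) => g ^ ((i : ℕ) * (j : ℕ))) hcode u p hp hpiv hech' lam hlam0
    apply key
    funext i
    apply φ.injective
    rw [Pi.zero_apply, map_zero]
    have hi := congr_fun hAv i
    rw [Pi.zero_apply, Matrix.mulVec, dotProduct] at hi
    rw [← hi, map_sum]
    refine Finset.sum_congr rfl fun t _ => ?_
    rw [map_mul, hlam]
    simp only [AlgEquiv.apply_symm_apply]
    rw [hentry, mul_comm, map_sum]
    congr 1
    refine Finset.sum_congr rfl fun j _ => ?_
    rw [mul_one, hφ, MvPolynomial.uniqueAlgEquiv_monomial, Finsupp.single_eq_same]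
  -- Step 2: transfer to `M`: `det (A U) = det (A M) · det P`
  have hdetU : (A * U.map (C : K →+* K[X])).det =
      (A * M.map (C : K →+* K[X])).det * C P.det := by
    rw [hUMP, Matrix.map_mul, ← Matrix.mul_assoc, Matrix.det_mul, ← RingHom.mapMatrix_apply,
      ← RingHom.map_det]
  have hAM : (A * M.map (C : K →+* K[X])).det ≠ 0 := by
    intro h; exact hAU (by rw [hdetU, h, zero_mul])
  have hPdet : P.det ≠ 0 := by
    intro h; exact hAU (by rw [hdetU, h, map_zero, mul_zero])
  refine ⟨hAM, ?_⟩
  -- Step 3: degree count on `A U`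
  have hdegEntry : ∀ i t, ((A * U.map (C : K →+* K[X])) i t).natDegree ≤ (p t : ℕ) := by
    intro i t
    rw [hentry]
    refine Polynomial.natDegree_sum_le_of_forall_le _ _ fun j _ => ?_
    by_cases hu : u t j = 0
    · simp [hu]
    · exact (Polynomial.natDegree_monomial_le _).trans (hech t j hu)
  have hdegAU : (A * U.map (C : K →+* K[X])).det.natDegree ≤ ∑ t, (p t : ℕ) := by
    rw [Matrix.det_apply']
    refine Polynomial.natDegree_sum_le_of_forall_le _ _ fun σ _ => ?_
    refine (Polynomial.natDegree_mul_le).trans ?_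
    rw [Polynomial.natDegree_intCast, zero_add]
    refine (Polynomial.natDegree_prod_le _ _).trans ?_
    exact Finset.sum_le_sum fun t _ => hdegEntry (σ t) t
  have hdegAM : (A * M.map (C : K →+* K[X])).det.natDegree =
      (A * U.map (C : K →+* K[X])).det.natDegree := by
    rw [hdetU, Polynomial.natDegree_mul_C hPdet]
  rw [hdegAM]
  exact (Nat.add_le_add_right hdegAU _).trans (sum_val_add_choose_le_mul p hp)

/-- **[ForbesShpilka2012, Thm. 4.1], polynomial form:** for `M ∈ K^{n×r}` with linearly
independent columns and `1, g, …, g^{n-1}` distinct, `det(A(X) · M) ≠ 0` in `K[X]`.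
[cite: ForbesShpilka2012, Thm. 4.1] locator: paper:arxiv-1111.0663 p0015.txt:L24–L31 -/
theorem det_condenser_mul_ne_zero {g : K} {n r : ℕ} (hg : Set.InjOn (fun k : ℕ => g ^ k) (Set.Iio n))
    (M : Matrix (Fin n) (Fin r) K) (hM : LinearIndependent K Mᵀ) :
    (condenser g r n * M.map (C : K →+* K[X])).det ≠ 0 :=
  (det_condenser_mul_ne_zero_and_natDegree_le hg M hM).1

/-- **[ForbesShpilka2012, Thm. 4.1], the degree bound:** `deg_α det(A M) ≤ nr − binom(r+1, 2)`,
typed without truncated subtraction. [cite: ForbesShpilka2012, Thm. 4.1 (proof)]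
locator: paper:arxiv-1111.0663 p0015.txt:L73–L75 -/
theorem natDegree_det_condenser_mul_add_choose_le {g : K} {n r : ℕ} (hg : Set.InjOn (fun k : ℕ => g ^ k) (Set.Iio n))
    (M : Matrix (Fin n) (Fin r) K) (hM : LinearIndependent K Mᵀ) :
    (condenser g r n * M.map (C : K →+* K[X])).det.natDegree + (r + 1).choose 2 ≤ n * r :=
  (det_condenser_mul_ne_zero_and_natDegree_le hg M hM).2

/-- **[ForbesShpilka2012, Thm. 4.1] as printed (counting form):** "there are
`≤ nr − binom(r+1, 2) < nr` values `α ∈ 𝕂` such that `rank(A_α M) < r`" — every finite set of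
`α` with `det(A_α M) = 0` has at most `nr − binom(r+1, 2)` elements (typed additively).
[cite: ForbesShpilka2012, Thm. 4.1] locator: paper:arxiv-1111.0663 p0015.txt:L24–L28 -/
theorem card_add_choose_le_of_det_eq_zero {g : K} {n r : ℕ} (hg : Set.InjOn (fun k : ℕ => g ^ k) (Set.Iio n))
    (M : Matrix (Fin n) (Fin r) K) (hM : LinearIndependent K Mᵀ) (S : Finset K)
    (hS : ∀ α ∈ S, (condenserAt g α r n * M).det = 0) : S.card + (r + 1).choose 2 ≤ n * r := by
  classical
  obtain ⟨hD, hdeg⟩ := det_condenser_mul_ne_zero_and_natDegree_le hg M hM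
  set D := (condenser g r n * M.map (C : K →+* K[X])).det with hDdef
  have hsub : S ⊆ D.roots.toFinset := by
    intro α hα
    rw [Multiset.mem_toFinset, Polynomial.mem_roots hD, Polynomial.IsRoot.def, hDdef,
      ← det_condenserAt_mul]
    exact hS α hα
  calc S.card + (r + 1).choose 2 ≤ D.roots.toFinset.card + (r + 1).choose 2 :=
        Nat.add_le_add_right (Finset.card_le_card hsub) _
    _ ≤ D.natDegree + (r + 1).choose 2 :=
        Nat.add_le_add_right ((Multiset.toFinset_card_le _).trans (Polynomial.card_roots' D)) _
    _ ≤ n * r := hdeg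

/-- The printed "`< nr`" (for `r ≥ 1`). [cite: ForbesShpilka2012, Thm. 4.1 ("As `r ≥ 1`,
`nr − binom(r+1, 2) < nr`")] locator: paper:arxiv-1111.0663 p0015.txt:L31 -/
theorem card_lt_of_det_eq_zero {g : K} {n r : ℕ} (hg : Set.InjOn (fun k : ℕ => g ^ k) (Set.Iio n)) (hr : 1 ≤ r)
    (M : Matrix (Fin n) (Fin r) K) (hM : LinearIndependent K Mᵀ) (S : Finset K)
    (hS : ∀ α ∈ S, (condenserAt g α r n * M).det = 0) : S.card < n * r := by
  have h := card_add_choose_le_of_det_eq_zero hg M hM S hS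
  have h2 : 1 ≤ (r + 1).choose 2 := Nat.succ_le_of_lt (Nat.choose_pos (by omega))
  omega

/-- Outside the bad set, `A_α M` is invertible, so `rank(A_α M) = r`.
[cite: ForbesShpilka2012, Thm. 4.1] locator: paper:arxiv-1111.0663 p0015.txt:L24–L28 -/
theorem rank_condenserAt_mul_eq_of_det_ne_zero {g α : K} {n r : ℕ} (M : Matrix (Fin n) (Fin r) K)
    (h : (condenserAt g α r n * M).det ≠ 0) : (condenserAt g α r n * M).rank = r := by
  classical
  rw [Matrix.rank_of_isUnit _ ((Matrix.isUnit_iff_isUnit_det _).mpr (isUnit_iff_ne_zero.mpr h)),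
    Fintype.card_fin]

/-! ### Cor. 4.3 (rank form, the shape used by [ForbesShpilka2013, Lemma 3.4 / 3.5]) -/

/-- A matrix of rank `s` has `s` linearly independent columns ("Consider `M' ∈ 𝔽^{n×s}` to be a
matrix formed from `s` basis columns of `M`"). [cite: ForbesShpilka2012, Cor. 4.3 (proof, first line)]
locator: paper:arxiv-1111.0663 p0016.txt:L19 -/
theorem exists_linearIndependent_cols {n : ℕ} {ρ : Type*} [Fintype ρ] (M : Matrix (Fin n) ρ K) :
    ∃ f : Fin M.rank → ρ, Function.Injective f ∧ LinearIndependent K (M.submatrix id f)ᵀ := by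
  classical
  obtain ⟨κ, a, ha, hspan, hli⟩ := exists_linearIndependent' K (M.col : ρ → Fin n → K)
  haveI : Finite κ := hli.finite
  haveI : Fintype κ := Fintype.ofFinite κ
  have hcard : Fintype.card κ = M.rank := by
    rw [Matrix.rank_eq_finrank_span_cols, ← hspan, finrank_span_eq_card hli]
  let e : Fin M.rank ≃ κ := (Fintype.equivFinOfCardEq hcard).symm
  refine ⟨a ∘ e, ha.comp e.injective, ?_⟩
  have : (M.submatrix id (a ∘ e))ᵀ = (M.col ∘ a) ∘ e := by
    funext t; ext i; rfl
  rw [this]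
  exact hli.comp _ e.injective

/-- **A consequence of [ForbesShpilka2012, Cor. 4.3] in rank form (the full-rank-drop form that
[ForbesShpilka2013, Lemma 3.5] consumes):** let `M ∈ K^{n×ρ}` have rank `s ≤ r` and let
`1, g, …, g^{n-1}` be distinct. Then every finite set of `α` with `rank(A_α M) < rank M` —
equivalently (as `rank(A_α M) ≤ rank M` always), with `rank(A_α M) ≠ rank M` — has at most
`ns − binom(s+1, 2)` (`≤ nr − binom(r+1, 2)` for `s ≤ r ≤ n`) elements.
Relation to the print: the set bounded here, `{α | rank(A_α M) < s}`, is CONTAINED IN the printed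
bad set of [ForbesShpilka2012, Cor. 4.3] / [ForbesShpilka2013, Lemma 3.4], `{α | the first s rows
of A_α M have rank < s}` (the rank of the first `s` rows is at most `rank(A_α M)`); the inclusion
is strict in general (e.g. `n = 2`, `r = 2`, `M = (−1, 1)ᵀ` of rank `s = 1`, `α = 1`: the first
row of `A_1 M` is `−1 + 1 = 0`, while `rank(A_1 M) = 1` as its second entry is `g − 1 ≠ 0`). So
this theorem is the (weaker-in-form) consequence of the printed corollary, not a restatement of it;
it is exactly the form used in the printed proof of [ForbesShpilka2013, Lemma 3.5] ("Since
`rank(C) ≥ rank(A_α C)` … rank is dropped for fewer than `nr` values of `α`", p0014.txt:L15–L17).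
Proof as printed: restrict to `s` basis columns `M'` and to the first `s` rows (the `s`-row
condenser), and apply Thm. 4.1.
[cite: ForbesShpilka2012, Cor. 4.3; ForbesShpilka2013, Lemma 3.4 (arXiv: Lemma 9)]
locator: paper:arxiv-1111.0663 p0016.txt:L12–L30; paper:arxiv-1209.2408 p0013.txt:L60–L63 -/
theorem card_add_choose_le_of_rank_lt {g : K} {n r : ℕ} {ρ : Type*} [Fintype ρ] (hg : Set.InjOn (fun k : ℕ => g ^ k) (Set.Iio n))
    (M : Matrix (Fin n) ρ K) (hr : M.rank ≤ r) (S : Finset K)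
    (hS : ∀ α ∈ S, (condenserAt g α r n * M).rank < M.rank) :
    S.card + (M.rank + 1).choose 2 ≤ n * M.rank := by
  classical
  obtain ⟨f, -, hli⟩ := exists_linearIndependent_cols M
  refine card_add_choose_le_of_det_eq_zero hg (M.submatrix id f) hli S fun α hα => ?_
  by_contra hdet
  have h1 : (condenserAt g α M.rank n * M.submatrix id f).rank = M.rank :=
    rank_condenserAt_mul_eq_of_det_ne_zero _ hdet
  have h2 : (condenserAt g α M.rank n * M.submatrix id f).rank ≤ (condenserAt g α r n * M).rank := by
    rw [← submatrix_condenserAt_mul g α hr M f]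
    exact Matrix.rank_submatrix_le _ _ _
  have h3 := hS α hα
  omega

/-- `rank(A_α M) ≤ rank M` for every `α` (so "rank preserved" fails only by dropping).
[cite: ForbesShpilka2013, Lemma 3.5 (proof: "Since `rank(C) ≥ rank(A_α C)`")]
locator: paper:arxiv-1209.2408 p0014.txt:L17 -/
theorem rank_condenserAt_mul_le {g α : K} {n r : ℕ} {ρ : Type*} [Fintype ρ]
    (M : Matrix (Fin n) ρ K) : (condenserAt g α r n * M).rank ≤ M.rank :=
  Matrix.rank_mul_le_right _ _

/-- **[ForbesShpilka2013, Lemma 3.4] with its printed count `< nr`:** for `M` of rank `s` with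
`1 ≤ s ≤ r` (print: `1 ≤ s ≤ r ≤ n`), fewer than `nr` values `α` have `rank(A_α M) < rank M`.
[cite: ForbesShpilka2013, Lemma 3.4 (arXiv: Lemma 9); ForbesShpilka2012, Cor. 4.3]
locator: paper:arxiv-1209.2408 p0013.txt:L60–L63 -/
theorem card_lt_of_rank_lt {g : K} {n r : ℕ} {ρ : Type*} [Fintype ρ] (hg : Set.InjOn (fun k : ℕ => g ^ k) (Set.Iio n))
    (M : Matrix (Fin n) ρ K) (h1 : 1 ≤ M.rank) (hr : M.rank ≤ r) (S : Finset K)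
    (hS : ∀ α ∈ S, (condenserAt g α r n * M).rank < M.rank) : S.card < n * r := by
  have h := card_add_choose_le_of_rank_lt hg M hr S hS
  have h2 : 1 ≤ (M.rank + 1).choose 2 := Nat.succ_le_of_lt (Nat.choose_pos (by omega))
  have h3 : n * M.rank ≤ n * r := Nat.mul_le_mul_left n hr
  omega

end FS2012

end Literature.Computability.AlgebraicComplexity
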